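import Literature.Probability.RandomPlanarGeometry.RestrictionMeasuresProofs
import HarnessLib

/-!
# The reflection `σ : x + iy ↦ −x + iy` acts on `Ω`, and `P_α` is `σ`-invariant ([LSW] Remark 3.7, Cor. 8.6)

Level 3 of the decomposition of the named fact
`Literature.Probability.RandomPlanarGeometry.IsRestrictionMeasure.eq_five_eighths_of_outer_simple` (file `RestrictionMeasures`; plan in
`RestrictionMeasuresFiveEighths`): the SYMMETRY ingredient of the proof of [LSW] Cor. 8.6, after

* G. F. Lawler, O. Schramm, W. Werner, *Conformal restriction: the chordal case*, J. Amer. Math.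
  Soc. **16** (2003) 917–955, arXiv:math/0209343 (**[LSW]**): Remark 3.7 (p. 14: "suppose [`P_α`]
  did [exist]. Since it is unique, it is invariant under the symmetry `σ : x + iy ↦ −x + iy`")
  and the proof of Cor. 8.6 (p. 38: "the same symmetry argument shows that for any `α > 0`, if
  the two-sided probability measure with exponent `α > 0` exists, then the `P_α` probability
  that `i` ends up to the 'right' of `K` is at most `1/2`").

All PROVED:

* `Literature.Probability.RandomPlanarGeometry.RestrictionConfig.reflect` — `σ` acts on `Ω` (`K ↦ σ(K)`; the tree's `imagAxisRefl`,
  `HullApproximation`): `σ(K)` is again relatively closed, connected, unbounded, with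
  `cl σ(K) ∩ ℝ = {0}` and `ℂ ∖ cl σ(K)` connected; an involution, MEASURABLE for the avoidance
  σ-field (`σ⁻¹{K ∩ A = ∅} = {K ∩ σ(A) = ∅}` and `σ(𝒬*) = 𝒬*`, `IsStarHull.image_imagAxisRefl`);
* `Literature.Probability.RandomPlanarGeometry.HasRestrictionDeriv.reflectHull` — `Φ'_{σ(A)}(0) = Φ'_A(0)` for the reflected restriction
  map `σ ∘ Φ_A ∘ σ` (`ConformalEquiv.reflectHull`, `IsRestrictionMap.reflectHull` of
  `HullApproximation`; the version for the arbitrary-set reflection `ConformalEquiv.reflectSet`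
  is `HasRestrictionDeriv.reflectSet` of `LoewnerReflection`, whose Loewner/SLE imports are not
  needed here);
* `Literature.Probability.RandomPlanarGeometry.IsRestrictionMeasure.map_reflect` — the image of `P_α` under `σ` is again a restriction
  measure with exponent `α` (`P[σK ∩ A = ∅] = P[K ∩ σA = ∅] = Φ'_{σA}(0)^α = Φ'_A(0)^α`);
* `Literature.Probability.RandomPlanarGeometry.IsRestrictionMeasure.map_reflect_eq` — **`P_α` is `σ`-invariant**, by uniqueness
  (`IsRestrictionMeasure.unique'`, `RestrictionMeasuresProofs`: Prop. 3.3 with Lemma 3.2, both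
  discharged);
* `Literature.Probability.RandomPlanarGeometry.IsRestrictionMeasure.measure_le_half_of_disjoint_reflect` — the symmetry bound of the
  proof of Cor. 8.6 in abstract form: a measurable event `E` disjoint from its mirror image
  `σ⁻¹(E)` has `P_α(E) ≤ 1/2`.

Mathlib: `measurable_generateFrom`, `MeasureTheory.Measure.map_apply`, `Homeomorph.image_closure`.
-/

noncomputable section

open Set Filter Topology MeasureTheory Metric Bornology Complex
open UpperHalfPlane (upperHalfPlaneSet isOpen_upperHalfPlaneSet)
open scoped NNReal ENNReal ComplexConjugate

namespace Literature.Probability.RandomPlanarGeometry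

/-! ### `Φ'_{σ(A)}(0) = Φ'_A(0)` -/

/-- **`Φ'_{σ(A)}(0) = Φ'_A(0)`**: the reflected map `σ ∘ Φ ∘ σ` of `ℍ ∖ σ(A)` has the same
derivative number at `0` (`σΦσ(z)/z = conj (Φ(σz)/σz) → conj d = d`). [cite: LawlerSchrammWerner2003Restriction, §2 p. 8 (𝒬₋ = σ(𝒬₊), by symmetry)] -/
theorem HasRestrictionDeriv.reflectHull {A : Set ℂ} (hA : IsClosed A)
    {Φ : ConformalEquiv (upperHalfPlaneSet \ A) upperHalfPlaneSet} {d : ℝ}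
    (h : HasRestrictionDeriv A Φ d) : HasRestrictionDeriv (imagAxisRefl '' A) (Φ.reflectHull hA) d := by
  show Tendsto (fun z ↦ imagAxisRefl (Φ (imagAxisRefl z)) / z)
    (𝓝[upperHalfPlaneSet \ imagAxisRefl '' A] 0) (𝓝 (d : ℂ))
  rw [← imagAxisRefl_image_diff]
  have h1 := h.comp (tendsto_imagAxisRefl_nhdsWithin (upperHalfPlaneSet \ A))
  have h2 : Tendsto (fun z ↦ conj (Φ (imagAxisRefl z) / imagAxisRefl z))
      (𝓝[imagAxisRefl '' (upperHalfPlaneSet \ A)] 0) (𝓝 (conj (d : ℂ))) :=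
    (Complex.continuous_conj.tendsto (d : ℂ)).comp h1
  rw [Complex.conj_ofReal] at h2
  refine h2.congr fun z ↦ ?_
  -- `conj (a / σ z) = σ a / z`
  simp only [imagAxisRefl_apply, map_div₀, map_neg, Complex.conj_conj]
  field_simp

namespace RestrictionConfig

/-! ### The reflection acts on `Ω` -/

/-- `σ` preserves the real axis (as a set). [folklore] -/
theorem imagAxisRefl_image_range_ofReal :
    imagAxisRefl '' range ((↑) : ℝ → ℂ) = range ((↑) : ℝ → ℂ) := by
  ext z
  constructor
  · rintro ⟨_, ⟨x, rfl⟩, rfl⟩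
    exact ⟨-x, by rw [imagAxisRefl_ofReal]⟩
  · rintro ⟨x, rfl⟩
    exact ⟨((-x : ℝ) : ℂ), ⟨-x, rfl⟩, by rw [imagAxisRefl_ofReal, neg_neg]⟩

/-- The mirror image of a configuration is a configuration. [folklore] -/
theorem imagAxisRefl_image_mem (K : RestrictionConfig) :
    imagAxisRefl '' (K : Set ℂ) ∈ restrictionConfigs := by
  obtain ⟨hcl, hconn, hR, hb, hcc⟩ := K.2
  refine ⟨?_, ?_, ?_, ?_, ?_⟩
  · rw [← imagAxisRefl.image_closure, ← imagAxisRefl_image_inter_upperHalfPlaneSet, hcl]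
  · exact hconn.image _ imagAxisRefl.continuous.continuousOn
  · rw [← imagAxisRefl.image_closure, ← imagAxisRefl_image_range_ofReal,
      ← image_inter imagAxisRefl.injective, hR]
    simp
  · intro h
    refine hb ?_
    obtain ⟨R, hRsub⟩ := h.subset_closedBall 0
    refine (isBounded_closedBall (x := (0 : ℂ)) (r := R)).subset fun z hz ↦ ?_
    simpa using hRsub (mem_image_of_mem imagAxisRefl hz)
  · rw [← imagAxisRefl.image_closure, ← imagAxisRefl.image_compl]
    exact hcc.image _ imagAxisRefl.continuous.continuousOn

/-- **The reflection `σ` on `Ω`**: `K ↦ σ(K) = {−x + iy : x + iy ∈ K}` ([LSW] Remark 3.7: "the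
symmetry `σ : x + iy ↦ −x + iy`"). [cite: LawlerSchrammWerner2003Restriction, Remark 3.7 (p. 14)] -/
def reflect (K : RestrictionConfig) : RestrictionConfig :=
  ⟨imagAxisRefl '' (K : Set ℂ), K.imagAxisRefl_image_mem⟩

/-- The underlying set of the reflected configuration. [folklore] -/
@[simp] theorem coe_reflect (K : RestrictionConfig) :
    ((reflect K : RestrictionConfig) : Set ℂ) = imagAxisRefl '' (K : Set ℂ) := rfl

/-- `σ` is an involution on `Ω`. [folklore] -/
@[simp] theorem reflect_reflect (K : RestrictionConfig) : reflect (reflect K) = K :=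
  Subtype.ext (imagAxisRefl_image_image _)

/-- `σ` on `Ω` is a bijection (an involution). [folklore] -/
theorem reflect_bijective : Function.Bijective reflect :=
  Function.Involutive.bijective reflect_reflect

/-- **`σ⁻¹{K ∩ A = ∅} = {K ∩ σ(A) = ∅}`.** [folklore] -/
@[simp] theorem reflect_preimage_avoid (A : Set ℂ) : reflect ⁻¹' avoid A = avoid (imagAxisRefl '' A) := by
  ext K
  simp only [mem_preimage, mem_avoid, coe_reflect, Set.disjoint_left, mem_image]
  constructor
  · rintro h z hzK ⟨w, hwA, rfl⟩
    exact h ⟨imagAxisRefl w, hzK, imagAxisRefl_imagAxisRefl w⟩ hwA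
  · rintro h _ ⟨z, hzK, rfl⟩ hzA
    exact h hzK ⟨imagAxisRefl z, hzA, imagAxisRefl_imagAxisRefl z⟩

/-- **`σ` is measurable** for the avoidance σ-field (it permutes the generating events,
`σ(𝒬*) = 𝒬*`). [folklore] -/
theorem measurable_reflect : Measurable reflect := by
  refine measurable_generateFrom ?_
  rintro _ ⟨A, hA, rfl⟩
  rw [reflect_preimage_avoid]
  exact measurableSet_avoid hA.image_imagAxisRefl

/-- `σ⁻¹(σ⁻¹(E)) = E`. [folklore] -/
@[simp] theorem reflect_preimage_preimage (E : Set RestrictionConfig) :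
    reflect ⁻¹' (reflect ⁻¹' E) = E := by
  ext K
  simp

end RestrictionConfig

/-! ### `P_α` is reflection invariant -/

open RestrictionConfig

/-- **The mirror image of `P_α` is a restriction measure with exponent `α`**:
`P[σ(K) ∩ A = ∅] = P[K ∩ σ(A) = ∅] = Φ'_{σ(A)}(0)^α = Φ'_A(0)^α`, using that restriction data
`(Φ, d)` of `A` reflect to restriction data `(σΦσ, d)` of `σ(A)`
(`IsRestrictionMap.reflectHull`, `HasRestrictionDeriv.reflectHull`).
[cite: LawlerSchrammWerner2003Restriction, Remark 3.7 (p. 14)] -/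
theorem IsRestrictionMeasure.map_reflect {α : ℝ} {P : Measure RestrictionConfig}
    (h : IsRestrictionMeasure α P) : IsRestrictionMeasure α (P.map reflect) := by
  haveI := h.isProbabilityMeasure
  refine ⟨Measure.isProbabilityMeasure_map measurable_reflect.aemeasurable, ?_⟩
  intro A hA Φ hΦ d hd
  have hAc : IsClosed A := hA.isBoundedHull.isClosed
  rw [Measure.map_apply measurable_reflect (measurableSet_avoid hA), reflect_preimage_avoid]
  exact h.2 hA.image_imagAxisRefl (hΦ.reflectHull hAc) (hd.reflectHull hAc)

/-- **`P_α` is invariant under `σ : x + iy ↦ −x + iy`** ([LSW] Remark 3.7: "Since it is unique,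
it is invariant under the symmetry `σ`"), by `map_reflect` and the uniqueness of `P_α`
(`IsRestrictionMeasure.unique'`). [cite: LawlerSchrammWerner2003Restriction, Remark 3.7 (p. 14) with Prop. 3.3] -/
theorem IsRestrictionMeasure.map_reflect_eq {α : ℝ} {P : Measure RestrictionConfig}
    (h : IsRestrictionMeasure α P) : P.map reflect = P :=
  h.map_reflect.unique' h

/-- Mirror events have the same `P_α`-probability. [cite: LawlerSchrammWerner2003Restriction, Remark 3.7 (p. 14)] -/
theorem IsRestrictionMeasure.measure_preimage_reflect {α : ℝ} {P : Measure RestrictionConfig}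
    (h : IsRestrictionMeasure α P) {E : Set RestrictionConfig} (hE : MeasurableSet E) :
    P (reflect ⁻¹' E) = P E := by
  conv_rhs => rw [← h.map_reflect_eq]
  rw [Measure.map_apply measurable_reflect hE]

/-- **The symmetry bound** (proof of [LSW] Cor. 8.6, p. 38: "the same symmetry argument shows
that … the `P_α` probability that `i` ends up to the 'right' of `K` is at most `1/2`"), in
abstract form: a measurable event disjoint from its mirror image has `P_α`-probability at most
`1/2`. [cite: LawlerSchrammWerner2003Restriction, proof of Cor. 8.6 (pp. 37–38)] -/
theorem IsRestrictionMeasure.measure_le_half_of_disjoint_reflect {α : ℝ}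
    {P : Measure RestrictionConfig} (h : IsRestrictionMeasure α P) {E : Set RestrictionConfig}
    (hE : MeasurableSet E) (hdisj : Disjoint E (reflect ⁻¹' E)) : P E ≤ 1 / 2 := by
  haveI := h.isProbabilityMeasure
  have hE' : MeasurableSet (reflect ⁻¹' E) := measurable_reflect hE
  have hsum : P E + P E ≤ 1 := by
    calc P E + P E = P E + P (reflect ⁻¹' E) := by rw [h.measure_preimage_reflect hE]
      _ = P (E ∪ reflect ⁻¹' E) := (measure_union hdisj hE').symm
      _ ≤ 1 := prob_le_one
  have h2 : 2 * P E ≤ 1 := by rwa [two_mul]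
  calc P E = 2⁻¹ * (2 * P E) := by
        rw [← mul_assoc, ENNReal.inv_mul_cancel (by norm_num) (by norm_num), one_mul]
    _ ≤ 2⁻¹ * 1 := by gcongr
    _ = 1 / 2 := by rw [mul_one, one_div]

end Literature.Probability.RandomPlanarGeometry

end
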